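import Summits.ResolutionOfSingularities.ResolutionOfSingularities.Theorems.PurelyInseparableDim4ResConeLightQuadTail
import Summits.ResolutionOfSingularities.ResolutionOfSingularities.Theorems.PurelyInseparableDim4ResConePowerChainTilt
import Summits.ResolutionOfSingularities.ResolutionOfSingularities.Theorems.PurelyInseparableDim4ResConeKeepBudget
import HarnessLib
import HarnessLib.Audit.Tags

/-!
# Purely inseparable four-folds — the FROZEN CONE of a translation-free power-cone tail: along a pure corner
# stretch of constant shade `d < p` with `e_G ≡ 3` the vertex form `ℓ_k` eventually has CONSTANT support `S`,
# `1 ≤ |S| ≤ 2`, every chart letter lies off `S`, `ℓ_{k+1} = λ_k ℓ_k` exactly (no tilt), and the first birth layer is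
# empty at every step; the power-cone LIGHT QUAD is an instance (every prime; cell `res-dim4-pi`, K2(p) lane, rung 1)

[OURS · counted 0 · cell `res-dim4-pi` · K2(p) lane (holder res-dim4-p-12 g4; K2(7) scoping v1 rung 0 (d): «is there a
two-slot / window game for the power cones at (7, d) at all») · seat res-dim4-p-3 g5.]  Nothing here proves K2(p) for any `p`,
`NoIsolatedTrap p p`, the Cossart–Jannsen–Saito theorem or resolution of singularities in dimension ≥ 4 / characteristic
`p` — NOT proved.  AI kernel work, weaker than expert review.

Input: res-dim4-p-2's POWER-CONE PACKAGE `chain_powerCone_package (p)` (slice B, any `d < p`: vertex forms `ℓ k ≠ 0`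
with `resVertex = ker ℓ k`, `resForm = a_k·ℓ_k^d`, `ℓ k (j k) + ℓ k ⬝ b k = 0`, `ℓ (k+1) i = λ_k ℓ k i` off the chart letter)
and the tilt law `chain_tilt_eq_zero_iff (p)`; FT `no_tail_of_eventually_free (p)`.
* **`powerCone_corner_frozen`** — on a TRANSLATION-FREE stretch (`b k = 0` for `k ≥ k₀`): `ℓ k (j k) = 0`, so the support
  `S_k = {i : ℓ k i ≠ 0}` is NON-DECREASING (`λ_k ≠ 0`) and misses the chart letter (`|S_k| ≤ 3`); hence it is eventually a
  constant `S`; `|S| = 3` would pin the chart letter for ever — a FREE tail, excluded by FT; so `1 ≤ |S| ≤ 2`, every later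
  chart letter lies OFF `S`, and `ℓ (k+1) (j k) = 0 = λ_k ℓ k (j k)`: the cone is FROZEN, `ℓ_{k+1} = λ_k ℓ_k` in all four
  coordinates.
* **`powerCone_corner_no_birthLayer`** (`1 ≤ d`) — no tilt ⟺ the first birth layer is empty (`chain_tilt_eq_zero_iff`):
  eventually `coeff_{μ + 2e_{j k}} G_k = 0` for every `x_{j k}`-free `μ` of degree `d − 1` (`G_k = F_k / x^{r_k}`).
* **`lightQuad_powerCone_frozen`** / **`lightQuad_powerCone_no_birthLayer`** — the power-cone LIGHT QUAD `(1,1,1,1)` at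
  `d = p − 3` is translation-free (`lightQuad_translation_eq_zero`), hence an instance: a frozen cone on `≤ 2` of the four
  boundary letters, charts among the other `≥ 2`, the chart changing infinitely often (FT), birth layers empty — the exact
  ENTRY POSITION of a would-be window game at `(p, p−3)` (res-dim4-p-3 g3/g4's C∞ game at `(5,4)` started from the same
  shape with `S = {f}`).
NOT here: any kill of the frozen regime (that is the game question of rung 0 (d)); binary cones (`e_G = 2`: the light quad is
dead there, `no_lightQuad_tail`).

[cite: CossartJannsenSaito2020, Thm. 3.10(4), Thm. 3.14, Thm. 9.3] [cite: HauserPerlega2019PRIMS, §2 (transform D′ of D)]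
bears_on: LADDER-RESOLUTION:D157-DOOR2 (res-dim4-pi · K2(p) · power cones · frozen cone of corner tails).  Supports
stmt-ResolutionOfSingularities-16155 (helper).
-/

set_option linter.dupNamespace false -- mandated namespace of this single-conjunct summit

noncomputable section

namespace Summit.ResolutionOfSingularities.ResolutionOfSingularities.Theorems.PIDim4

namespace ResCone

open MvPolynomial Finset
open Literature.AlgebraicGeometry.Resolution
open Literature.AlgebraicGeometry.Resolution.CentreBlowup
open Literature.AlgebraicGeometry.Resolution.Hauser2010
open Literature.AlgebraicGeometry.Resolution.HauserPerlega2019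

variable {K : Type} [Field K] [DecidableEq K]

/-- **THE FROZEN CONE OF A TRANSLATION-FREE POWER-CONE TAIL** (every prime `p`, every shade `d < p`): along a witnessed
isolated above-floor `Step0 p` chain with `x^{r₀} ∣ F₀`, constant shade `d` and `e_G ≡ 3` from `k₀`, and NO translation from
`k₀` on, there are vertex forms `ℓ k`, cone coefficients `a k`, units `λ k`, a time `k₁ ≥ k₀` and a set `S` of letters with
`1 ≤ |S| ≤ 2` such that for every `k ≥ k₁`: `ℓ k ≠ 0` cuts out `resVertex (c k)`, `resForm (c k) = a_k·ℓ_k^d`, `λ k ≠ 0`,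
`ℓ (k+1) = λ_k·ℓ k` in ALL four coordinates (no tilt), the support of `ℓ k` is exactly `S`, and the chart letter `j k ∉ S`.
[OURS] [cite: CossartJannsenSaito2020, Thm. 3.10(4), Thm. 3.14] -/
theorem powerCone_corner_frozen (p : ℕ) [Fact p.Prime] [CharP K p] {c : ℕ → State K} {j : ℕ → Fin 4}
    {b : ℕ → Fin 4 → K} (hc : ∀ k, IsIsolated p (c k).F ∧ Step0 p (c k) (c (k + 1)))
    (hw : FreeTail.IsWitnessedChain p c j b) (hr0 : ∀ e ∈ (c 0).F.support, (c 0).r ≤ e)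
    (hfloor : ∀ k, ordZero (c k).F ≠ p) {k₀ d : ℕ} (hdp : d < p) (hshade : ∀ k, k₀ ≤ k → (c k).shade = (d : ℕ∞))
    (he3 : ∀ k, k₀ ≤ k → Module.finrank K (resVertex (c k)) = 3) (hcorner : ∀ k, k₀ ≤ k → ∀ i, b k i = 0) :
    ∃ (ℓ : ℕ → Fin 4 → K) (a lam : ℕ → K) (k₁ : ℕ) (S : Finset (Fin 4)),
      k₀ ≤ k₁ ∧ 1 ≤ S.card ∧ S.card ≤ 2 ∧ ∀ k, k₁ ≤ k →
        ℓ k ≠ 0 ∧ (∀ w, w ∈ resVertex (c k) ↔ dotProduct (ℓ k) w = 0) ∧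
        resForm (c k) = C (a k) * (∑ i, C (ℓ k i) * X i) ^ d ∧
        lam k ≠ 0 ∧ (∀ i, ℓ (k + 1) i = lam k * ℓ k i) ∧ (∀ i, ℓ k i ≠ 0 ↔ i ∈ S) ∧ j k ∉ S := by
  classical
  obtain ⟨ℓ, a, lam, hpack⟩ := chain_powerCone_package p hc hw hr0 hfloor hdp hshade he3
  -- pure corner: the chart coefficient of the vertex form vanishes
  have hb0 : ∀ k, k₀ ≤ k → b k = 0 := fun k hk => funext (hcorner k hk)
  have hjk : ∀ k, k₀ ≤ k → ℓ k (j k) = 0 := by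
    intro k hk
    obtain ⟨-, -, -, hj, -⟩ := hpack k hk
    rwa [hb0 k hk, dotProduct_zero, add_zero] at hj
  -- supports of the vertex forms
  set S : ℕ → Finset (Fin 4) := fun k => Finset.univ.filter (fun i => ℓ k i ≠ 0) with hS
  have hmemS : ∀ k i, i ∈ S k ↔ ℓ k i ≠ 0 := fun k i => by simp [hS]
  have hmono : ∀ k, k₀ ≤ k → S k ⊆ S (k + 1) := by
    intro k hk i hi
    rw [hmemS] at hi ⊢
    have hij : i ≠ j k := fun h => hi (h ▸ hjk k hk)
    obtain ⟨-, -, -, -, hlam0, hlam, -⟩ := hpack k hk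
    rw [hlam i hij]
    exact mul_ne_zero hlam0 hi
  have hnot : ∀ k, k₀ ≤ k → j k ∉ S k := fun k hk h => (hmemS k (j k)).mp h (hjk k hk)
  have hcard3 : ∀ k, k₀ ≤ k → (S k).card ≤ 3 := by
    intro k hk
    have h : (S k).card < (Finset.univ : Finset (Fin 4)).card :=
      Finset.card_lt_card ⟨Finset.subset_univ _, fun hsub => hnot k hk (hsub (Finset.mem_univ _))⟩
    rw [Finset.card_univ, Fintype.card_fin] at h
    omega
  have hcard1 : ∀ k, k₀ ≤ k → 1 ≤ (S k).card := by
    intro k hk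
    obtain ⟨-, -, -, -, -, -, i, -, hi⟩ := hpack k hk
    exact Finset.card_pos.mpr ⟨i, (hmemS k i).mpr hi⟩
  have hcmono : ∀ k, k₀ ≤ k → ∀ n, S k ⊆ S (k + n) := by
    intro k hk n
    induction n with
    | zero => simp
    | succ n ih => exact ih.trans (hmono (k + n) (by omega))
  -- the support is eventually constant
  have hev : ∃ k₁, k₀ ≤ k₁ ∧ ∀ k, k₁ ≤ k → (S k).card = (S k₁).card := by
    by_contra hno
    push Not at hno
    have hgrow : ∀ m, ∃ k, k₀ ≤ k ∧ m ≤ (S k).card := by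
      intro m
      induction m with
      | zero => exact ⟨k₀, le_rfl, Nat.zero_le _⟩
      | succ m ih =>
        obtain ⟨k, hk, hm⟩ := ih
        obtain ⟨k', hk', hne⟩ := hno k hk
        obtain ⟨n, rfl⟩ := Nat.exists_eq_add_of_le hk'
        have hle := Finset.card_le_card (hcmono k hk n)
        exact ⟨k + n, by omega, by omega⟩
    obtain ⟨k, hk, h4⟩ := hgrow 4
    have := hcard3 k hk
    omega
  obtain ⟨k₁, hk₁, hconst⟩ := hev
  have hSeq : ∀ k, k₁ ≤ k → S k = S k₁ := by
    intro k hk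
    obtain ⟨n, rfl⟩ := Nat.exists_eq_add_of_le hk
    exact (Finset.eq_of_subset_of_card_le (hcmono k₁ hk₁ n) (hconst _ hk).le).symm
  -- three letters in the support would pin the chart letter for ever: a free tail
  have hS3 : (S k₁).card ≠ 3 := by
    intro h3
    refine no_tail_of_eventually_free p hc hw (k₁ := k₁) fun k hk => Or.inl ?_
    have hc1 : ((S k₁)ᶜ).card ≤ 1 := by
      rw [Finset.card_compl, Fintype.card_fin, h3]
    have hjm : j k ∈ (S k₁)ᶜ := by
      rw [Finset.mem_compl, ← hSeq k hk]; exact hnot k (by omega)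
    have hjm' : j (k + 1) ∈ (S k₁)ᶜ := by
      rw [Finset.mem_compl, ← hSeq (k + 1) (by omega)]; exact hnot (k + 1) (by omega)
    exact Finset.card_le_one.mp hc1 _ hjm' _ hjm
  refine ⟨ℓ, a, lam, k₁, S k₁, hk₁, hcard1 k₁ hk₁, by have := hcard3 k₁ hk₁; omega, fun k hk => ?_⟩
  obtain ⟨hℓ, hV, hform, -, hlam0, hlam, -⟩ := hpack k (by omega)
  refine ⟨hℓ, hV, hform, hlam0, fun i => ?_, fun i => by rw [← hmemS, hSeq k hk], ?_⟩
  · by_cases hij : i = j k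
    · subst hij
      have h1 : ℓ (k + 1) (j k) = 0 := by
        have h := hnot k (by omega)
        rw [hSeq k hk, ← hSeq (k + 1) (by omega), hmemS] at h
        push Not at h
        exact h
      rw [h1, hjk k (by omega), mul_zero]
    · exact hlam i hij
  · rw [← hSeq k hk]; exact hnot k (by omega)

/-- **NO BIRTH LAYER ON A TRANSLATION-FREE POWER-CONE TAIL** (every prime `p`, `1 ≤ d < p`): with the cone frozen (no tilt),
`chain_tilt_eq_zero_iff` empties the first birth layer at every later step: `coeff_{μ + 2e_{j k}} (F_k / x^{r_k}) = 0` for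
every `x_{j k}`-free `μ` of degree `d − 1`. [OURS] [cite: CossartJannsenSaito2020, Thm. 3.10(4), Thm. 9.3] -/
theorem powerCone_corner_no_birthLayer (p : ℕ) [Fact p.Prime] [CharP K p] {c : ℕ → State K} {j : ℕ → Fin 4}
    {b : ℕ → Fin 4 → K} (hc : ∀ k, IsIsolated p (c k).F ∧ Step0 p (c k) (c (k + 1)))
    (hw : FreeTail.IsWitnessedChain p c j b) (hr0 : ∀ e ∈ (c 0).F.support, (c 0).r ≤ e)
    (hfloor : ∀ k, ordZero (c k).F ≠ p) {k₀ d : ℕ} (hd1 : 1 ≤ d) (hdp : d < p)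
    (hshade : ∀ k, k₀ ≤ k → (c k).shade = (d : ℕ∞))
    (he3 : ∀ k, k₀ ≤ k → Module.finrank K (resVertex (c k)) = 3) (hcorner : ∀ k, k₀ ≤ k → ∀ i, b k i = 0) :
    ∃ k₁, k₀ ≤ k₁ ∧ ∀ k, k₁ ≤ k → ∀ μ : Fin 4 →₀ ℕ, μ (j k) = 0 → μ.degree + 1 = d →
      coeff (μ + Finsupp.single (j k) 2) ((c k).F.divMonomial (c k).r) = 0 := by
  obtain ⟨ℓ, a, lam, k₁, S, hk₁, -, -, hfro⟩ :=
    powerCone_corner_frozen p hc hw hr0 hfloor hdp hshade he3 hcorner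
  refine ⟨k₁, hk₁, fun k hk μ hμj hμ => ?_⟩
  obtain ⟨-, -, -, hlam0, hlam, hsupp, hjS⟩ := hfro k hk
  obtain ⟨-, -, hform', -, -, -, -⟩ := hfro (k + 1) (by omega)
  have hℓ : ∃ i, i ≠ j k ∧ ℓ k i ≠ 0 := by
    obtain ⟨hℓ0, -⟩ := hfro k hk
    obtain ⟨i, hi⟩ := Function.ne_iff.mp hℓ0
    exact ⟨i, fun h => hjS ((hsupp i).mp (by simpa using hi) |> (h ▸ ·)), by simpa using hi⟩
  have htilt : ℓ (k + 1) (j k) = 0 := by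
    have h : j k ∉ S := hjS
    rw [hlam (j k)]
    have : ℓ k (j k) = 0 := by
      by_contra hne
      exact h ((hsupp (j k)).mp hne)
    rw [this, mul_zero]
  have h := (chain_tilt_eq_zero_iff p hc hw hr0 hfloor hd1 hdp hshade (k := k) (by omega) hform'
    (fun i _ => hlam i) hlam0 hℓ).mp htilt μ hμj hμ
  have hb0 : b k = 0 := funext (hcorner k (by omega))
  rwa [hb0, shear_zero] at h

/-- **THE POWER-CONE LIGHT QUAD HAS A FROZEN CONE**, every prime `p`: along a witnessed isolated above-floor `Step0 p` chain
with `x^{r₀} ∣ F₀`, constant shade `d = p − 3`, `e_G ≡ 3` and LIGHT for ever (`(1,1,1,1)`), the stretch is translation-free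
(`lightQuad_translation_eq_zero`), so `powerCone_corner_frozen` applies: a frozen cone supported on `1 ≤ |S| ≤ 2` of the
four boundary letters, every chart letter among the other ones. [OURS] [cite: CossartJannsenSaito2020, Thm. 3.14] -/
theorem lightQuad_powerCone_frozen (p : ℕ) [Fact p.Prime] [CharP K p] {c : ℕ → State K} {j : ℕ → Fin 4}
    {b : ℕ → Fin 4 → K} (hc : ∀ k, IsIsolated p (c k).F ∧ Step0 p (c k) (c (k + 1)))
    (hw : FreeTail.IsWitnessedChain p c j b) (hr0 : ∀ e ∈ (c 0).F.support, (c 0).r ≤ e)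
    (hfloor : ∀ k, ordZero (c k).F ≠ p) {k₀ d : ℕ} (h3 : d + 3 = p)
    (hshade : ∀ k, k₀ ≤ k → (c k).shade = (d : ℕ∞))
    (he3 : ∀ k, k₀ ≤ k → Module.finrank K (resVertex (c k)) = 3)
    (hlight : ∀ k, k₀ ≤ k → (∀ i, (c k).r i ≤ 1) ∧ (c k).r.degree + d = p + 1) :
    ∃ (ℓ : ℕ → Fin 4 → K) (a lam : ℕ → K) (k₁ : ℕ) (S : Finset (Fin 4)),
      k₀ ≤ k₁ ∧ 1 ≤ S.card ∧ S.card ≤ 2 ∧ ∀ k, k₁ ≤ k →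
        ℓ k ≠ 0 ∧ (∀ w, w ∈ resVertex (c k) ↔ dotProduct (ℓ k) w = 0) ∧
        resForm (c k) = C (a k) * (∑ i, C (ℓ k i) * X i) ^ d ∧
        lam k ≠ 0 ∧ (∀ i, ℓ (k + 1) i = lam k * ℓ k i) ∧ (∀ i, ℓ k i ≠ 0 ↔ i ∈ S) ∧ j k ∉ S :=
  powerCone_corner_frozen p hc hw hr0 hfloor (by omega) hshade he3
    fun k hk i => lightQuad_translation_eq_zero p hc hw hr0 hfloor hshade h3 hlight hk i

/-- **THE POWER-CONE LIGHT QUAD HAS EMPTY BIRTH LAYERS**, every prime `p ≥ 5` (`d = p − 3 ≥ 1`... in fact `≥ 2`): eventually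
`coeff_{μ + 2e_{j k}} (F_k / x^{r_k}) = 0` for every `x_{j k}`-free `μ` of degree `d − 1`. [OURS]
[cite: CossartJannsenSaito2020, Thm. 3.10(4), Thm. 9.3] -/
theorem lightQuad_powerCone_no_birthLayer (p : ℕ) [Fact p.Prime] [CharP K p] {c : ℕ → State K} {j : ℕ → Fin 4}
    {b : ℕ → Fin 4 → K} (hc : ∀ k, IsIsolated p (c k).F ∧ Step0 p (c k) (c (k + 1)))
    (hw : FreeTail.IsWitnessedChain p c j b) (hr0 : ∀ e ∈ (c 0).F.support, (c 0).r ≤ e)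
    (hfloor : ∀ k, ordZero (c k).F ≠ p) {k₀ d : ℕ} (hd1 : 1 ≤ d) (h3 : d + 3 = p)
    (hshade : ∀ k, k₀ ≤ k → (c k).shade = (d : ℕ∞))
    (he3 : ∀ k, k₀ ≤ k → Module.finrank K (resVertex (c k)) = 3)
    (hlight : ∀ k, k₀ ≤ k → (∀ i, (c k).r i ≤ 1) ∧ (c k).r.degree + d = p + 1) :
    ∃ k₁, k₀ ≤ k₁ ∧ ∀ k, k₁ ≤ k → ∀ μ : Fin 4 →₀ ℕ, μ (j k) = 0 → μ.degree + 1 = d →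
      coeff (μ + Finsupp.single (j k) 2) ((c k).F.divMonomial (c k).r) = 0 :=
  powerCone_corner_no_birthLayer p hc hw hr0 hfloor hd1 (by omega) hshade he3
    fun k hk i => lightQuad_translation_eq_zero p hc hw hr0 hfloor hshade h3 hlight hk i

end ResCone

end Summit.ResolutionOfSingularities.ResolutionOfSingularities.Theorems.PIDim4

end
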